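import Summits.ABC.IUTFork.Cor312StatementBridge
import Summits.ABC.IUTFork.Cor312StatementBridges
import HarnessLib

/-!
# The fork at [IUTchIII] Corollary 3.12 — LOCAL versus GLOBAL readings of Step (xi) (skeleton XXIV)

Record-only file (D-0012) of the abc-iut cell (skeleton seat abc-iut-skel, gen 4); TAKES NO SIDE. The cell's SUFFICIENT
READINGS of the disputed Step (xi-f) of the proof of [IUTchIII] Cor. 3.12 (S. Mochizuki, *Inter-universal Teichmüller
theory III*, kurims May 2020 = `paper:url-4b091feeb646`), typed over abc-iut-c312-7's verbatim `Cor312.Setting` — R0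
"pointwise volumes", R4 "containment up to isomorphism" (`Cor312ReadingIso`), R2 "`q`-region ⊆ packet hull", R3 "`q`-region
IS a possible image" (`Cor312StatementBridge`), Team B's `VolumeTransport` (`Cor312LogKummerRoute`) — all quantify PER
PACKET, `∀ (j ∈ 𝔽_l^⋇) (v_ℚ ∈ 𝕍_ℚ)`; the one GLOBAL reading is R1 `RepresentedVol` (skeleton XVII; LANA §8.3 / (9-1)). This
file types the QUANTIFIER FORK and proves both horns; every hypothesis is named; nothing about the intended model is asserted.

WHAT THE PRINT COMPARES: two GLOBAL real numbers — (xi-d) p. 183 display "`ℝ_{≤−|log(Θ)|} := {λ ∈ ℝ | λ ≤ −|log(Θ)|} ⊆ ℝ;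
−|log(q)| ∈ ℝ`"; (xi-f)/(xi-g) p. 184 "the pilot-object log-volume … `−|log(q)| ∈ ℝ`", "two tautologically equivalent ways
to compute the log-volume of the q-pilot object". Step (xii), p. 185 l. 59 – p. 186 l. 3, verbatim, on why nothing local
is meant: "to work only with local Frobenioids means that one must contend with the indeterminacy of not knowing whether
… such a local Frobenioid object at some `v ∈ 𝕍^non` corresponds to a given open submodule of the log-shell at `v` or to,
say, the `p_v^N`-multiple of this submodule, for `N ∈ ℤ` … This indeterminacy has the effect of rendering meaningless any
attempt to perform a precise log-volume computation as in (xi)." The Θ-side UPPER BOUND of [IUTchIV] Thm. 1.10 (kurims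
Apr 2020 = `paper:url-56bcb0f95768`), by contrast, IS per packet: Step (iv) p. 27 "we proceed to estimate this log-volume
at each `v_ℚ ∈ 𝕍_ℚ` … for each `j ∈ {1, …, l⋇}` … and then computing the average, over `j`"; Step (v) p. 28, per `(j, v_ℚ)`:
"`(j+1)·log(𝔡^K_{v_ℚ}) − (j²/2l)·log(𝔮_{v_ℚ}) + log(𝔰^ℚ_{v_ℚ}) + 4(j+1)·l*_mod·log(𝔰^≤_{v_ℚ})`" — shape `thetaLocal ≤ w·qLocal + κ`,
`w = j²`, the `q`-component being `−(1/2l)·log(𝔮_{v_ℚ})`, `κ` = local different/conductor/`l` terms, independent of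
`ord_v(q_v)`, which [IUTchI] Def. 3.1 bounds by nothing (clause (c) = coprimality with `l`; tree
`Literature.IUT.HodgeTheaters.InitialThetaData.l_coprime_qParamOrd`).

THE FORK. LOCAL horn (§1; witness in XXIVb): per-packet reading ∘ per-packet upper bound = PER-PLACE bound `(w−1)·|qLocal(j,v_ℚ)| ≤ κ`
(`perPlace_bound_of_pointwise`, algebra); and the per-packet readings are STRICTLY stronger than the Corollary — the
companion `ForkLocalGlobalWitness` (XXIVb, `LocalGlobal.fork`): a verbatim setting with ALL of c312-6's `BridgeHyps`,
"`|log(q)| > 0`", the printed `Statement` AND R1, in which R0 (hence R2, R3, R4, `VolumeTransport`, which factor through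
it) FAILS (a deficit at one label set against a surplus at the other; with two places the same bookkeeping runs place
against place). GLOBAL horn (§2): under the "coarse
space" of Step (x) (p. 181 l. 5–13, log-volumes "invariant with respect to (Ind1), (Ind2)"; kernel form = the conclusion of
abc-iut-c312-10's `StepX.LogvolCoarse.adm_and_logvol_eq_of_mem_possibleImages` / abc-iut-c312-1's
`logvol_eq_of_mem_possibleImages`, a named hypothesis here) all global image-choices have ONE assembled volume, so R1 is
the EXACT EQUALITY "`−|log(q)|` = that volume" (`representedVol_iff_of_coarse`) and R3 the per-packet equalities
`qLocal = logvol(thetaRegion3)`; the print's "possible pilot-object log-volumes" is the half-line `ℝ_{≤−|log(Θ)|}` BY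
DEFINITION ((xi-d)), and Rmk. 3.12.1 (ii) p. 186 calls the estimate "sufficiently rough as to be unaffected by adding a
constant of absolute value ≤ 1". CONSEQUENCE (recorded, not adjudicated): over the frozen `Setting` the weakest GLOBAL
volume statement implying the Corollary is the Corollary; a non-circular gap statement must quantify over what
(xi-e)/(xi-f) quantify over — the multiradial algorithm as a FUNCTION of its input prime-strip and the column-1
pilot volume of that input (p. 184 l. 19–24). [claim: Mochizuki2012, status: disputed]
[cite: LANA2026Report, §8.3 p. 43] Deliberately NOT here: the real-model form of the upper bound (campaign S / c312-3 /
c312-d1); any claim that a reading holds or fails for the intended instantiation; any judgement on (xi-f).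
-/

noncomputable section

namespace Summit.ABC

namespace IUTFork

namespace Cor312Vol

open Thm311 Cor312 Literature.IUT.LogThetaLattice

variable {T : ThetaIndex} {S : Situation T} {P : Cor312.Setting S}

/-! ## 1. The LOCAL horn: a per-packet reading plus a per-packet upper bound is a per-place bound -/

/-- **Per-packet reading ∘ per-packet upper bound = per-place bound.** If at ONE packet `(j = i+1, v_ℚ)` the `q`-pilot
log-volume is at most the hull volume (R0 there — what R2/R3/R4/`VolumeTransport` give) and the hull volume obeys a bound
of the [IUTchIV] Thm. 1.10 Step (v) shape `thetaLocal ≤ w·qLocal + κ` (`w = j²`, p. 28), then `(w − 1)·(−qLocal) ≤ κ`: a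
bound on the local height at this one place. Pure algebra; the content is that BOTH inputs are per packet.
[claim: Mochizuki2012, status: disputed] -/
theorem perPlace_bound_of_pointwise {i : Fin T.lstar} {vQ : T.VQ} {w κ : ℝ}
    (h0 : P.qLocal (Setting.labelSucc i) vQ ≤ (P.thetaLocal (Setting.labelSucc i) vQ).untopD 0)
    (hUB : (P.thetaLocal (Setting.labelSucc i) vQ).untopD 0 ≤ w * P.qLocal (Setting.labelSucc i) vQ + κ) :
    (w - 1) * (-P.qLocal (Setting.labelSucc i) vQ) ≤ κ := by
  linear_combination h0.trans hUB

/-- READING 2 at one packet gives READING 0 there (monotonicity on admissible regions; the `q`-region is a hull-set, the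
packet hull admissible under `ThetaFinite`): the set-level readings enter the volumes only through this. [folklore] -/
theorem qLocal_le_thetaLocal_of_qRegion_subset (H : BridgeHyps P) {i : Fin T.lstar} {vQ : T.VQ}
    (h : P.qRegion (Setting.labelSucc i) vQ ⊆ P.thetaHull (Setting.labelSucc i) vQ) :
    P.qLocal (Setting.labelSucc i) vQ ≤ (P.thetaLocal (Setting.labelSucc i) vQ).untopD 0 := by
  rw [thetaLocal_untopD H]
  exact H.mono i vQ (P.hul_adm _ vQ _ (P.qRegion_mem _ vQ)) (P.thetaHull_adm (hullDefined_of_finite H i vQ)) h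

/-! ## 2. The GLOBAL horn: membership readings are equalities under the coarse space of Step (x) -/

/-- **R3 is a per-packet EQUALITY under the coarse space**: if every possible image at `(j, v_ℚ)` has the log-volume of
the (Ind3)-union (Step (x), p. 181; c312-10 `LogvolCoarse.adm_and_logvol_eq_of_mem_possibleImages` / c312-1
`logvol_eq_of_mem_possibleImages`) and the `q`-region IS a possible image (R3), then `qLocal = logvol(thetaRegion3)` there —
an exact value, not a bound. [claim: Mochizuki2012, status: disputed] -/
theorem qLocal_eq_logvol_thetaRegion3_of_mem {j : T.Label} {vQ : T.VQ}
    (hcoarse : ∀ U ∈ P.possibleImages j vQ, (S.D P.n).logvol j vQ U = (S.D P.n).logvol j vQ (P.thetaRegion3 j vQ))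
    (h3 : P.qRegion j vQ ∈ P.possibleImages j vQ) :
    P.qLocal j vQ = (S.D P.n).logvol j vQ (P.thetaRegion3 j vQ) :=
  hcoarse _ h3

/-- Hence R3 at every packet pins `−|log(q)|` to the procession-normalized sum of the (Ind3)-union volumes.
[claim: Mochizuki2012, status: disputed] -/
theorem negLogQ_eq_of_forall_qRegion_mem
    (hcoarse : ∀ (i : Fin T.lstar) (vQ : T.VQ), ∀ U ∈ P.possibleImages (Setting.labelSucc i) vQ,
      (S.D P.n).logvol _ vQ U = (S.D P.n).logvol _ vQ (P.thetaRegion3 (Setting.labelSucc i) vQ))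
    (h3 : ∀ (i : Fin T.lstar) (vQ : T.VQ),
      P.qRegion (Setting.labelSucc i) vQ ∈ P.possibleImages (Setting.labelSucc i) vQ) :
    P.negLogQ = processionNormalized fun i : Fin T.lstar =>
      ∑ᶠ vQ : T.VQ, (S.D P.n).logvol _ vQ (P.thetaRegion3 (Setting.labelSucc i) vQ) := by
  unfold Setting.negLogQ
  congr 1
  funext i
  exact finsum_congr fun vQ => qLocal_eq_logvol_thetaRegion3_of_mem (hcoarse i vQ) (h3 i vQ)

/-- **All global image-choices have ONE assembled volume under the coarse space** (c312-6's `ImageChoice`; the "set of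
log-volumes of possible images" is a singleton). [claim: Mochizuki2012, status: disputed] -/
theorem imageChoice_logvol_eq_of_coarse (H : BridgeHyps P)
    (hcoarse : ∀ (i : Fin T.lstar) (vQ : T.VQ), ∀ U ∈ P.possibleImages (Setting.labelSucc i) vQ,
      (S.D P.n).logvol _ vQ U = (S.D P.n).logvol _ vQ (P.thetaRegion3 (Setting.labelSucc i) vQ))
    (U : ImageChoice P) :
    (toLocalFamily P H.mono).assemble.logvol (Set.univ.pi U.1) =
      ∑ᶠ t : Fin T.lstar × T.VQ,
        (1 / (T.lstar : ℝ)) * (S.D P.n).logvol _ t.2 (P.thetaRegion3 (Setting.labelSucc t.1) t.2) := by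
  rw [LocalFamily.assemble_logvol_pi _ _ fun t => possibleImages_nonempty H _ _ (U.2 t)]
  refine finsum_congr fun t => ?_
  show (1 / (T.lstar : ℝ)) * (S.D P.n).logvol _ t.2 (U.1 t) = _
  rw [hcoarse t.1 t.2 _ (U.2 t)]

/-- **R1 is a GLOBAL EQUALITY under the coarse space**: `RepresentedVol` of the verbatim setting (LANA §8.3 / (9-1) at
volume level, `statement_of_represented`) holds IFF `−|log(q)|` EQUALS the one assembled volume of the (Ind3)-unions.
[claim: Mochizuki2012, status: disputed] [cite: LANA2026Report, §8.3 p. 43] -/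
theorem representedVol_iff_of_coarse (H : BridgeHyps P)
    (hcoarse : ∀ (i : Fin T.lstar) (vQ : T.VQ), ∀ U ∈ P.possibleImages (Setting.labelSucc i) vQ,
      (S.D P.n).logvol _ vQ U = (S.D P.n).logvol _ vQ (P.thetaRegion3 (Setting.labelSucc i) vQ)) :
    (toCor312Setting H).RepresentedVol ↔
      (∑ᶠ t : Fin T.lstar × T.VQ,
          (1 / (T.lstar : ℝ)) * (S.D P.n).logvol _ t.2 (P.thetaRegion3 (Setting.labelSucc t.1) t.2)) =
        P.negLogQ := by
  rw [← toCor312Setting_negAbsLogq H]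
  constructor
  · rintro ⟨U, hU⟩
    rw [← imageChoice_logvol_eq_of_coarse H hcoarse U]
    exact hU
  · intro h
    let U₀ : ImageChoice P := ⟨fun t => P.thetaRegion3 _ t.2, fun t => P.thetaRegion3_mem_possibleImages _ t.2⟩
    refine ⟨U₀, ?_⟩
    show (toLocalFamily P H.mono).assemble.logvol (Set.univ.pi U₀.1) = _
    rw [imageChoice_logvol_eq_of_coarse H hcoarse U₀]
    exact h

end Cor312Vol

end IUTFork

end Summit.ABC

end
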